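import Mathlib
import Summits.AtomisticToContinuum.FouriersLaw.Theses.EmbeddedDrudeMourre
import Summits.AtomisticToContinuum.FouriersLaw.Theorems.EmbeddedDrudeMourreDrudeDissolutionStubExcursionSecondDifferenceGradientFloorFar
import Summits.AtomisticToContinuum.FouriersLaw.Theorems.EmbeddedDrudeMourreDrudeDissolutionStubExcursionSecondDifferenceGradientFloorCornerAux
import HarnessLib

/-!
# Geometry of the free pair resonance for stub B1b″ of line `kinetic-polymer-gas-on-the-time-axis`:
# the Morse gradient floor at the two extremal critical points of `Ω`
(crux `EmbeddedDrudeMourre.DrudeDissolution`, item stmt-AtomisticToContinuum-12593; `--supports` file, closes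
nothing; lead c13, sub-goal M5b-corner of the B1b″ plan)

WHAT. `resonanceFn_gradient_floor_corner`: for `ω₂ > 0` there are `r, c > 0` such that, with `Ω` read at
`p = (k₁,(k₃,k₂))`, `‖DΩ(p)‖ ≥ c·‖p − p₀‖` whenever `‖p − p₀‖ < r`, for every `2πℤ³`-translate `p₀` of the two
extremal critical points `(k₁,k₂,k₃) = (0,0,π)` (global minimum `−2(ω(π)−ω(0))`) and `(π,π,0)` (global maximum) —
i.e. the two isolated critical points of `Ω` are NON-DEGENERATE (Morse), with the explicit constant
`c = 1/(6 ω(π)) = 1/(6√(ω₂+4))`. With `resonanceFn_gradient_floor_far` (the bulk) this leaves only the co-moving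
curves in the exchange planes (Morse–Bott, M5b-curve) for the gradient-floor input of the second-difference estimate.

HOW. Near `(0,0,π)` write `(k₁,k₂,k₃) = (a, b, π+c)`; the group velocity satisfies `v(x) = x/ω(0) + o(x)` and
`v(π+x) = −x/ω(π) + o(x)` (`hasDerivAt_groupVelocity` at `0` and `π`), so the three partials of `Ω` are
`a/ω₀ + (a+b−c)/ω_π`, `b/ω₀ + (a+b−c)/ω_π`, `(2c−a−b)/ω_π` up to `ε(|a|+|b|+|c|)`; pairing with `(a,b,c)` gives the
Hessian form `(a²+b²)/ω₀ + ((a+b−c)² + c²)/ω_π ≥ (a²+b²+c²)/ω_π`, whence `max|∂ⱼΩ| ≥ ‖(a,b,c)‖_∞/(6ω_π)` once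
`18ε ≤ 1/ω_π` (`corner_floor_alg`); the corner `(π,π,0)` is the same computation with `ω₀ ↔ ω_π` and all signs
flipped. Periodicity (`fderiv_resonanceFn₃_add_int_mul`) moves `p₀` to any `2πℤ³`-translate.
-/

noncomputable section

open Set Real Topology Filter Asymptotics
open Literature.MathematicalPhysics.KineticTheory
open Literature.MathematicalPhysics.KineticTheory.PhononBoltzmann

namespace Summit.AtomisticToContinuum.FouriersLaw.Theorems.DrudeDissolution.KineticPolymerGasOnTheTimeAxis

/-! ### The local Morse floors at the two corners -/

/-- **Local Morse floor at the minimum `(k₁,k₂,k₃) = (0,0,π)`.** For `ω₂ > 0` there are `r, c > 0` with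
`c·max(|a|,|c′|,|b|) ≤ ‖DΩ(a, π + c′, b)‖` whenever `|a|, |b|, |c′| < r` (`Ω` read at `p = (k₁,(k₃,k₂))`).
[folklore] -/
theorem resonanceFn_gradient_floor_corner_min {ω₂ : ℝ} (hω : 0 < ω₂) :
    ∃ r c : ℝ, 0 < r ∧ 0 < c ∧ ∀ a b c' : ℝ, |a| < r → |b| < r → |c'| < r →
      c * max |a| (max |c'| |b|) ≤
        ‖fderiv ℝ (fun q : ℝ × ℝ × ℝ => resonanceFn ω₂ q.1 q.2.2 q.2.1) (a, Real.pi + c', b)‖ := by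
  have hd0 : 0 < dispersion ω₂ 0 := dispersion_pos hω 0
  have hdπ : 0 < dispersion ω₂ Real.pi := dispersion_pos hω Real.pi
  have hα : 0 < 1 / dispersion ω₂ 0 := by positivity
  have hβ : 0 < 1 / dispersion ω₂ Real.pi := by positivity
  have hmin : 0 < min (1 / dispersion ω₂ 0) (1 / dispersion ω₂ Real.pi) := lt_min hα hβ
  -- Taylor tolerance `ε/2` with `ε = min/18`
  obtain ⟨δ, hδ, hT⟩ := groupVelocity_taylor_edges hω
    (half_pos (div_pos hmin (by norm_num : (0 : ℝ) < 18)))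
  have hvper := groupVelocity_periodic ω₂
  refine ⟨δ / 3, min (1 / dispersion ω₂ 0) (1 / dispersion ω₂ Real.pi) / 6, by positivity, by positivity,
    fun a b c ha hb hc => ?_⟩
  obtain ⟨e1, e3, e2⟩ := fderiv_resonanceFn₃_apply_basis hω (a, Real.pi + c, b)
  obtain ⟨b1, b3, b2⟩ := abs_fderiv_apply_basis_le
    (fderiv ℝ (fun q : ℝ × ℝ × ℝ => resonanceFn ω₂ q.1 q.2.2 q.2.1) (a, Real.pi + c, b))
  simp only at e1 e2 e3
  -- `k₄ = a + b − (π + c) ≡ π + (a + b − c)`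
  have hk4 : groupVelocity ω₂ (a + b - (Real.pi + c)) = groupVelocity ω₂ (Real.pi + (a + b - c)) := by
    have := hvper.sub_eq (Real.pi + (a + b - c))
    rw [show Real.pi + (a + b - c) - 2 * Real.pi = a + b - (Real.pi + c) by ring] at this
    exact this
  rw [hk4] at e1 e2 e3
  -- Taylor control of the four velocities
  have hs : |a + b - c| ≤ |a| + |b| + |c| :=
    (abs_sub _ _).trans (by linarith [abs_add_le a b])
  have habc : |a + b - c| < δ := by linarith
  have hδ3 : δ / 3 ≤ δ := by linarith
  obtain ⟨ta, -⟩ := hT a (ha.trans_le hδ3)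
  obtain ⟨tb, -⟩ := hT b (hb.trans_le hδ3)
  obtain ⟨-, tc⟩ := hT c (hc.trans_le hδ3)
  obtain ⟨-, t4⟩ := hT (a + b - c) habc
  have hε0 : 0 ≤ min (1 / dispersion ω₂ 0) (1 / dispersion ω₂ Real.pi) / 18 / 2 := by positivity
  -- the three approximate linear forms
  have h1 : |fderiv ℝ (fun q : ℝ × ℝ × ℝ => resonanceFn ω₂ q.1 q.2.2 q.2.1) (a, Real.pi + c, b) (1, 0, 0) -
      (1 / dispersion ω₂ 0 * a + 1 / dispersion ω₂ Real.pi * (a + b - c))| ≤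
      min (1 / dispersion ω₂ 0) (1 / dispersion ω₂ Real.pi) / 18 * (|a| + |b| + |c|) := by
    rw [e1, show groupVelocity ω₂ a - groupVelocity ω₂ (Real.pi + (a + b - c)) -
        (1 / dispersion ω₂ 0 * a + 1 / dispersion ω₂ Real.pi * (a + b - c)) =
        (groupVelocity ω₂ a - a / dispersion ω₂ 0) -
          (groupVelocity ω₂ (Real.pi + (a + b - c)) + (a + b - c) / dispersion ω₂ Real.pi) by ring]
    refine (abs_sub _ _).trans ((add_le_add ta t4).trans ?_)
    nlinarith [abs_nonneg a, abs_nonneg b, abs_nonneg c]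
  have h2 : |fderiv ℝ (fun q : ℝ × ℝ × ℝ => resonanceFn ω₂ q.1 q.2.2 q.2.1) (a, Real.pi + c, b) (0, 0, 1) -
      (1 / dispersion ω₂ 0 * b + 1 / dispersion ω₂ Real.pi * (a + b - c))| ≤
      min (1 / dispersion ω₂ 0) (1 / dispersion ω₂ Real.pi) / 18 * (|a| + |b| + |c|) := by
    rw [e2, show groupVelocity ω₂ b - groupVelocity ω₂ (Real.pi + (a + b - c)) -
        (1 / dispersion ω₂ 0 * b + 1 / dispersion ω₂ Real.pi * (a + b - c)) =
        (groupVelocity ω₂ b - b / dispersion ω₂ 0) -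
          (groupVelocity ω₂ (Real.pi + (a + b - c)) + (a + b - c) / dispersion ω₂ Real.pi) by ring]
    refine (abs_sub _ _).trans ((add_le_add tb t4).trans ?_)
    nlinarith [abs_nonneg a, abs_nonneg b, abs_nonneg c]
  have h3 : |fderiv ℝ (fun q : ℝ × ℝ × ℝ => resonanceFn ω₂ q.1 q.2.2 q.2.1) (a, Real.pi + c, b) (0, 1, 0) -
      1 / dispersion ω₂ Real.pi * (2 * c - a - b)| ≤
      min (1 / dispersion ω₂ 0) (1 / dispersion ω₂ Real.pi) / 18 * (|a| + |b| + |c|) := by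
    rw [e3, show groupVelocity ω₂ (Real.pi + (a + b - c)) - groupVelocity ω₂ (Real.pi + c) -
        1 / dispersion ω₂ Real.pi * (2 * c - a - b) =
        (groupVelocity ω₂ (Real.pi + (a + b - c)) + (a + b - c) / dispersion ω₂ Real.pi) -
          (groupVelocity ω₂ (Real.pi + c) + c / dispersion ω₂ Real.pi) by ring]
    refine (abs_sub _ _).trans ((add_le_add t4 tc).trans ?_)
    nlinarith [abs_nonneg a, abs_nonneg b, abs_nonneg c]
  have key := corner_floor_alg hα hβ (by positivity) (by linarith) h1 h2 h3
  rw [max_comm |b| |c|] at key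
  exact key.trans (max_le b1 (max_le b2 b3))

/-- **Local Morse floor at the maximum `(k₁,k₂,k₃) = (π,π,0)`.** For `ω₂ > 0` there are `r, c > 0` with
`c·max(|a|,|c′|,|b|) ≤ ‖DΩ(π + a, c′, π + b)‖` whenever `|a|, |b|, |c′| < r`. [folklore] -/
theorem resonanceFn_gradient_floor_corner_max {ω₂ : ℝ} (hω : 0 < ω₂) :
    ∃ r c : ℝ, 0 < r ∧ 0 < c ∧ ∀ a b c' : ℝ, |a| < r → |b| < r → |c'| < r →
      c * max |a| (max |c'| |b|) ≤
        ‖fderiv ℝ (fun q : ℝ × ℝ × ℝ => resonanceFn ω₂ q.1 q.2.2 q.2.1) (Real.pi + a, c', Real.pi + b)‖ := by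
  have hd0 : 0 < dispersion ω₂ 0 := dispersion_pos hω 0
  have hdπ : 0 < dispersion ω₂ Real.pi := dispersion_pos hω Real.pi
  have hα : 0 < 1 / dispersion ω₂ Real.pi := by positivity
  have hβ : 0 < 1 / dispersion ω₂ 0 := by positivity
  have hmin : 0 < min (1 / dispersion ω₂ Real.pi) (1 / dispersion ω₂ 0) := lt_min hα hβ
  obtain ⟨δ, hδ, hT⟩ := groupVelocity_taylor_edges hω
    (half_pos (div_pos hmin (by norm_num : (0 : ℝ) < 18)))
  have hvper := groupVelocity_periodic ω₂
  refine ⟨δ / 3, min (1 / dispersion ω₂ Real.pi) (1 / dispersion ω₂ 0) / 6, by positivity, by positivity,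
    fun a b c ha hb hc => ?_⟩
  obtain ⟨e1, e3, e2⟩ := fderiv_resonanceFn₃_apply_basis hω (Real.pi + a, c, Real.pi + b)
  obtain ⟨b1, b3, b2⟩ := abs_fderiv_apply_basis_le
    (fderiv ℝ (fun q : ℝ × ℝ × ℝ => resonanceFn ω₂ q.1 q.2.2 q.2.1) (Real.pi + a, c, Real.pi + b))
  simp only at e1 e2 e3
  -- `k₄ = (π + a) + (π + b) − c = (a + b − c) + 2π`
  have hk4 : groupVelocity ω₂ (Real.pi + a + (Real.pi + b) - c) = groupVelocity ω₂ (a + b - c) := by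
    have := hvper (a + b - c)
    rw [show a + b - c + 2 * Real.pi = Real.pi + a + (Real.pi + b) - c by ring] at this
    exact this
  rw [hk4] at e1 e2 e3
  have hs : |a + b - c| ≤ |a| + |b| + |c| :=
    (abs_sub _ _).trans (by linarith [abs_add_le a b])
  have habc : |a + b - c| < δ := by linarith
  have hδ3 : δ / 3 ≤ δ := by linarith
  obtain ⟨-, ta⟩ := hT a (ha.trans_le hδ3)
  obtain ⟨-, tb⟩ := hT b (hb.trans_le hδ3)
  obtain ⟨tc, -⟩ := hT c (hc.trans_le hδ3)
  obtain ⟨t4, -⟩ := hT (a + b - c) habc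
  have hε0 : 0 ≤ min (1 / dispersion ω₂ Real.pi) (1 / dispersion ω₂ 0) / 18 / 2 := by positivity
  -- the NEGATED partials fit the template with `α = 1/ω(π)`, `β = 1/ω(0)`
  have h1 : |-(fderiv ℝ (fun q : ℝ × ℝ × ℝ => resonanceFn ω₂ q.1 q.2.2 q.2.1) (Real.pi + a, c, Real.pi + b)
        (1, 0, 0)) - (1 / dispersion ω₂ Real.pi * a + 1 / dispersion ω₂ 0 * (a + b - c))| ≤
      min (1 / dispersion ω₂ Real.pi) (1 / dispersion ω₂ 0) / 18 * (|a| + |b| + |c|) := by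
    rw [e1, show -(groupVelocity ω₂ (Real.pi + a) - groupVelocity ω₂ (a + b - c)) -
        (1 / dispersion ω₂ Real.pi * a + 1 / dispersion ω₂ 0 * (a + b - c)) =
        (groupVelocity ω₂ (a + b - c) - (a + b - c) / dispersion ω₂ 0) -
          (groupVelocity ω₂ (Real.pi + a) + a / dispersion ω₂ Real.pi) by ring]
    refine (abs_sub _ _).trans ((add_le_add t4 ta).trans ?_)
    nlinarith [abs_nonneg a, abs_nonneg b, abs_nonneg c]
  have h2 : |-(fderiv ℝ (fun q : ℝ × ℝ × ℝ => resonanceFn ω₂ q.1 q.2.2 q.2.1) (Real.pi + a, c, Real.pi + b)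
        (0, 0, 1)) - (1 / dispersion ω₂ Real.pi * b + 1 / dispersion ω₂ 0 * (a + b - c))| ≤
      min (1 / dispersion ω₂ Real.pi) (1 / dispersion ω₂ 0) / 18 * (|a| + |b| + |c|) := by
    rw [e2, show -(groupVelocity ω₂ (Real.pi + b) - groupVelocity ω₂ (a + b - c)) -
        (1 / dispersion ω₂ Real.pi * b + 1 / dispersion ω₂ 0 * (a + b - c)) =
        (groupVelocity ω₂ (a + b - c) - (a + b - c) / dispersion ω₂ 0) -
          (groupVelocity ω₂ (Real.pi + b) + b / dispersion ω₂ Real.pi) by ring]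
    refine (abs_sub _ _).trans ((add_le_add t4 tb).trans ?_)
    nlinarith [abs_nonneg a, abs_nonneg b, abs_nonneg c]
  have h3 : |-(fderiv ℝ (fun q : ℝ × ℝ × ℝ => resonanceFn ω₂ q.1 q.2.2 q.2.1) (Real.pi + a, c, Real.pi + b)
        (0, 1, 0)) - 1 / dispersion ω₂ 0 * (2 * c - a - b)| ≤
      min (1 / dispersion ω₂ Real.pi) (1 / dispersion ω₂ 0) / 18 * (|a| + |b| + |c|) := by
    rw [e3, show -(groupVelocity ω₂ (a + b - c) - groupVelocity ω₂ c) - 1 / dispersion ω₂ 0 * (2 * c - a - b) =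
        (groupVelocity ω₂ c - c / dispersion ω₂ 0) -
          (groupVelocity ω₂ (a + b - c) - (a + b - c) / dispersion ω₂ 0) by ring]
    refine (abs_sub _ _).trans ((add_le_add tc t4).trans ?_)
    nlinarith [abs_nonneg a, abs_nonneg b, abs_nonneg c]
  have key := corner_floor_alg hα hβ (by positivity) (by linarith) h1 h2 h3
  rw [abs_neg, abs_neg, abs_neg, max_comm |b| |c|] at key
  exact key.trans (max_le b1 (max_le b2 b3))

/-! ### The Morse floor at all translates of the two corners -/

/-- **Registered sub-goal `resonanceFn_gradient_floor_corner` (M5b-corner of stub B1b″): the two extremal critical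
points of the free pair resonance are non-degenerate.** For `ω₂ > 0` there are `r, c > 0` such that for every
`n₁ n₂ n₃ ∈ ℤ` and every `p = (k₁,(k₃,k₂)) ∈ ℝ³`: if `‖p − p₀‖ < r` then `c‖p − p₀‖ ≤ ‖DΩ(p)‖`, both for
`p₀ = (2πn₁, (π + 2πn₃, 2πn₂))` (the minimum `(k₁,k₂,k₃) = (0,0,π)` mod `2π`) and for
`p₀ = (π + 2πn₁, (2πn₃, π + 2πn₂))` (the maximum `(π,π,0)` mod `2π`). (`‖·‖` is the sup norm of `ℝ × ℝ × ℝ`.)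
[folklore] -/
theorem resonanceFn_gradient_floor_corner :
    ∀ ω₂ : ℝ, 0 < ω₂ → ∃ r c : ℝ, 0 < r ∧ 0 < c ∧ ∀ (n₁ n₂ n₃ : ℤ) (p : ℝ × ℝ × ℝ),
      (‖p - (2 * Real.pi * n₁, Real.pi + 2 * Real.pi * n₃, 2 * Real.pi * n₂)‖ < r →
        c * ‖p - (2 * Real.pi * n₁, Real.pi + 2 * Real.pi * n₃, 2 * Real.pi * n₂)‖ ≤
          ‖fderiv ℝ (fun q : ℝ × ℝ × ℝ => resonanceFn ω₂ q.1 q.2.2 q.2.1) p‖) ∧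
      (‖p - (Real.pi + 2 * Real.pi * n₁, 2 * Real.pi * n₃, Real.pi + 2 * Real.pi * n₂)‖ < r →
        c * ‖p - (Real.pi + 2 * Real.pi * n₁, 2 * Real.pi * n₃, Real.pi + 2 * Real.pi * n₂)‖ ≤
          ‖fderiv ℝ (fun q : ℝ × ℝ × ℝ => resonanceFn ω₂ q.1 q.2.2 q.2.1) p‖) := by
  intro ω₂ hω
  obtain ⟨r₁, c₁, hr₁, hc₁, hmin⟩ := resonanceFn_gradient_floor_corner_min hω
  obtain ⟨r₂, c₂, hr₂, hc₂, hmax⟩ := resonanceFn_gradient_floor_corner_max hω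
  refine ⟨min r₁ r₂, min c₁ c₂, lt_min hr₁ hr₂, lt_min hc₁ hc₂, fun n₁ n₂ n₃ p => ⟨fun hr => ?_, fun hr => ?_⟩⟩
  · -- the minimum: `p = (a, π + c, b) + 2π(n₁, n₃, n₂)`
    have hn : ‖p - (2 * Real.pi * n₁, Real.pi + 2 * Real.pi * n₃, 2 * Real.pi * n₂)‖ =
        max |p.1 - 2 * Real.pi * n₁| (max |p.2.1 - (Real.pi + 2 * Real.pi * n₃)| |p.2.2 - 2 * Real.pi * n₂|) := by
      simp only [Prod.norm_def, Prod.fst_sub, Prod.snd_sub, Real.norm_eq_abs]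
    have hlt := lt_of_lt_of_le hr (min_le_left _ _)
    rw [hn] at hlt
    have ha : |p.1 - 2 * Real.pi * n₁| < r₁ := lt_of_le_of_lt (le_max_left _ _) hlt
    have hc : |p.2.1 - (Real.pi + 2 * Real.pi * n₃)| < r₁ :=
      lt_of_le_of_lt ((le_max_left _ _).trans (le_max_right _ _)) hlt
    have hb : |p.2.2 - 2 * Real.pi * n₂| < r₁ :=
      lt_of_le_of_lt ((le_max_right _ _).trans (le_max_right _ _)) hlt
    have h := hmin _ _ _ ha hb hc
    have hp : p = ((p.1 - 2 * Real.pi * n₁, Real.pi + (p.2.1 - (Real.pi + 2 * Real.pi * n₃)),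
        p.2.2 - 2 * Real.pi * n₂) : ℝ × ℝ × ℝ) + (2 * Real.pi * n₁, 2 * Real.pi * n₃, 2 * Real.pi * n₂) := by
      ext <;> simp only [Prod.fst_add, Prod.snd_add] <;> ring
    have hder := fderiv_resonanceFn₃_add_int_mul ω₂ ((p.1 - 2 * Real.pi * n₁,
      Real.pi + (p.2.1 - (Real.pi + 2 * Real.pi * n₃)), p.2.2 - 2 * Real.pi * n₂) : ℝ × ℝ × ℝ) n₁ n₂ n₃
    rw [← hp] at hder
    rw [hder, hn]
    refine le_trans ?_ h
    exact mul_le_mul_of_nonneg_right (min_le_left _ _) (by positivity)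
  · -- the maximum: `p = (π + a, c, π + b) + 2π(n₁, n₃, n₂)`
    have hn : ‖p - (Real.pi + 2 * Real.pi * n₁, 2 * Real.pi * n₃, Real.pi + 2 * Real.pi * n₂)‖ =
        max |p.1 - (Real.pi + 2 * Real.pi * n₁)| (max |p.2.1 - 2 * Real.pi * n₃| |p.2.2 - (Real.pi + 2 * Real.pi * n₂)|) := by
      simp only [Prod.norm_def, Prod.fst_sub, Prod.snd_sub, Real.norm_eq_abs]
    have hlt := lt_of_lt_of_le hr (min_le_right _ _)
    rw [hn] at hlt
    have ha : |p.1 - (Real.pi + 2 * Real.pi * n₁)| < r₂ := lt_of_le_of_lt (le_max_left _ _) hlt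
    have hc : |p.2.1 - 2 * Real.pi * n₃| < r₂ :=
      lt_of_le_of_lt ((le_max_left _ _).trans (le_max_right _ _)) hlt
    have hb : |p.2.2 - (Real.pi + 2 * Real.pi * n₂)| < r₂ :=
      lt_of_le_of_lt ((le_max_right _ _).trans (le_max_right _ _)) hlt
    have h := hmax _ _ _ ha hb hc
    have hp : p = ((Real.pi + (p.1 - (Real.pi + 2 * Real.pi * n₁)), p.2.1 - 2 * Real.pi * n₃,
        Real.pi + (p.2.2 - (Real.pi + 2 * Real.pi * n₂))) : ℝ × ℝ × ℝ) +
        (2 * Real.pi * n₁, 2 * Real.pi * n₃, 2 * Real.pi * n₂) := by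
      ext <;> simp only [Prod.fst_add, Prod.snd_add] <;> ring
    have hder := fderiv_resonanceFn₃_add_int_mul ω₂ ((Real.pi + (p.1 - (Real.pi + 2 * Real.pi * n₁)),
      p.2.1 - 2 * Real.pi * n₃, Real.pi + (p.2.2 - (Real.pi + 2 * Real.pi * n₂))) : ℝ × ℝ × ℝ) n₁ n₂ n₃
    rw [← hp] at hder
    rw [hder, hn]
    refine le_trans ?_ h
    exact mul_le_mul_of_nonneg_right (min_le_right _ _) (by positivity)

end Summit.AtomisticToContinuum.FouriersLaw.Theorems.DrudeDissolution.KineticPolymerGasOnTheTimeAxis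

end
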